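import Mathlib

/-!
# Crux `ConvexGateBlind` (stmt-PneNP-10680): the perfect-matching core — degree-2 PSD objects are blind at every shift

Helpers (`--supports stmt-PneNP-10680`; prover seat 2, session 27), sequel of `…MatchingCore`. The PSD half of the
matching core `(|M ∩ δ(U)| − ε)_{U odd, M}` is EASY at `ε = 0` with ONE `n × n` block and the canonical cut-side
objects `H_U = s_U s_Uᵀ` (`s_U = ±1_U`): `|M ∩ δ(U)| = s_Uᵀ ((I − A_M)/4) s_U`. Here: this class dies at EVERY positive
shift. For a fixed-point-free involution `σ` of `Fin n` (`n ≥ 5`; the matching `{{v, σ v}}`), `ε > 0` and PSD `Y`,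
the identities `s_Uᵀ Y s_U = ¼ Σ_v (1 − s_U(v) s_U(σ v)) − ε` for all ODD `U` are contradictory
(`pm_degreeTwo_psd_blind`): averaging over the odd half-cube against `1` and `s_u s_{σu}` — odd sets are
`(n−1)`-wise symmetric, `Σ_{U odd} Π_{z∈T} s_U(z) = 0` when a coordinate lies outside `T ∋ x`
(`sum_odd_prod_sgnVec_eq_zero`, the involution `U ↦ U ∆ {x,y}`) — pins `tr Y = n/4 − ε` and `Y_{u,σu} = −1/4`, while
`(e_u + e_{σu})ᵀ Y (e_u + e_{σu}) ≥ 0` gives `Y_{uu} + Y_{σu σu} ≥ 1/2`, so `tr Y ≥ n/4`. The obstruction is the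
PARITY of `#U`; contrast the triangle/`K₄` instances of line xor-door, PSD-cheap at every shift `≤ 3/4` (lead c5).
Everything here is elementary. [folklore]
-/
set_option linter.dupNamespace false -- `Summit.PneNP.PneNP.…`: summit = sub-problem (D-0017)

namespace Summit.PneNP.PneNP.Cruxes.ConvexGateBlind.StrictRankConicCover

open Finset Matrix

noncomputable section
variable {n : ℕ}

/-! ## §1 Signed cut vectors and the symmetry of the odd half-cube -/

/-- The `±1` vector of a vertex set: `s_U(v) = 1` if `v ∈ U`, `−1` otherwise. [folklore] -/
def sgnVec (U : Finset (Fin n)) (v : Fin n) : ℝ := if v ∈ U then 1 else -1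

/-- `s_U(v)² = 1`. [folklore] -/
theorem sgnVec_mul_self (U : Finset (Fin n)) (v : Fin n) : sgnVec U v * sgnVec U v = 1 := by
  unfold sgnVec; split_ifs <;> norm_num

/-- Flipping the pair `{x, y}`: the sign vector of `U ∆ {x, y}` is `s_U` with the coordinates `x` and `y` negated.
[folklore] -/
theorem sgnVec_symmDiff_pair (U : Finset (Fin n)) (x y v : Fin n) :
    sgnVec (symmDiff U {x, y}) v = if v = x ∨ v = y then - sgnVec U v else sgnVec U v := by
  unfold sgnVec
  simp only [Finset.mem_symmDiff, Finset.mem_insert, Finset.mem_singleton]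
  by_cases hv : v = x ∨ v = y <;> by_cases hU : v ∈ U <;> simp [hv, hU]

/-- Flipping a pair preserves the parity of the cardinality (`x ≠ y`). [folklore] -/
theorem odd_card_symmDiff_pair {U : Finset (Fin n)} {x y : Fin n} (hxy : x ≠ y) (hU : Odd U.card) :
    Odd (symmDiff U {x, y}).card := by
  have h : (symmDiff U {x, y}).card + 2 * (U ∩ {x, y}).card = U.card + ({x, y} : Finset (Fin n)).card := by
    rw [Finset.symmDiff_def, Finset.card_union_of_disjoint disjoint_sdiff_sdiff]
    have h1 := Finset.card_sdiff_add_card_inter U {x, y}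
    have h2 := Finset.card_sdiff_add_card_inter {x, y} U
    rw [Finset.inter_comm {x, y} U] at h2
    omega
  rw [Finset.card_pair hxy] at h
  rw [Nat.odd_iff] at hU ⊢
  omega

/-- **Symmetry of the odd half-cube.** If `x ∈ T` and `y ∉ T`, then `Σ_{U odd} Π_{z ∈ T} s_U(z) = 0`: the involution
`U ↦ U ∆ {x, y}` preserves oddness and negates the monomial. [folklore] -/
theorem sum_odd_prod_sgnVec_eq_zero {T : Finset (Fin n)} {x y : Fin n} (hx : x ∈ T) (hy : y ∉ T) :
    ∑ U ∈ (univ : Finset (Finset (Fin n))).filter (fun U => Odd U.card), ∏ z ∈ T, sgnVec U z = 0 := by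
  have hxy : x ≠ y := fun h => hy (h ▸ hx)
  have hflip : ∀ U : Finset (Fin n), ∏ z ∈ T, sgnVec (symmDiff U {x, y}) z = - ∏ z ∈ T, sgnVec U z := by
    intro U
    have h1 : ∏ z ∈ T, sgnVec (symmDiff U {x, y}) z =
        ∏ z ∈ T, (if z = x then - sgnVec U z else sgnVec U z) := by
      refine Finset.prod_congr rfl fun z hz => ?_
      rw [sgnVec_symmDiff_pair]
      have hzy : z ≠ y := fun h => hy (h ▸ hz)
      by_cases hzx : z = x <;> simp [hzx, hzy]
    rw [h1, ← Finset.mul_prod_erase T _ hx, ← Finset.mul_prod_erase T (fun z => sgnVec U z) hx]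
    simp only [if_true, neg_mul]
    congr 2
    exact Finset.prod_congr rfl fun z hz => by rw [if_neg (Finset.ne_of_mem_erase hz)]
  refine Finset.sum_involution (fun U _ => symmDiff U {x, y}) (fun U _ => ?_) (fun U _ hne => ?_)
    (fun U hU => ?_) (fun U _ => ?_)
  · rw [hflip]; ring
  · intro h
    apply hxy
    have hx' : x ∈ symmDiff U {x, y} ↔ x ∈ U := by rw [h]
    simp [Finset.mem_symmDiff] at hx'
  · simp only [Finset.mem_filter, Finset.mem_univ, true_and] at hU ⊢
    exact odd_card_symmDiff_pair hxy hU
  · exact symmDiff_symmDiff_cancel_right {x, y} U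

/-- Pair character: for `a ≠ b` and a coordinate `y ∉ {a, b}`, `Σ_{U odd} s_U(a) s_U(b) = 0`. [folklore] -/
theorem sum_odd_sgnVec_pair_eq_zero {a b y : Fin n} (hab : a ≠ b) (hya : y ≠ a) (hyb : y ≠ b) :
    ∑ U ∈ (univ : Finset (Finset (Fin n))).filter (fun U => Odd U.card), sgnVec U a * sgnVec U b = 0 := by
  have h := sum_odd_prod_sgnVec_eq_zero (T := {a, b}) (x := a) (y := y) (by simp) (by simp [hya, hyb])
  simpa [Finset.prod_pair hab] using h

/-- Quadruple character: for distinct `a, b, c, d` and `y ∉ {a, b, c, d}`,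
`Σ_{U odd} s_U(a) s_U(b) s_U(c) s_U(d) = 0`. [folklore] -/
theorem sum_odd_sgnVec_quad_eq_zero {a b c d y : Fin n} (hab : a ≠ b) (hac : a ≠ c) (had : a ≠ d) (hbc : b ≠ c)
    (hbd : b ≠ d) (hcd : c ≠ d) (hya : y ≠ a) (hyb : y ≠ b) (hyc : y ≠ c) (hyd : y ≠ d) :
    ∑ U ∈ (univ : Finset (Finset (Fin n))).filter (fun U => Odd U.card),
      sgnVec U a * sgnVec U b * (sgnVec U c * sgnVec U d) = 0 := by
  have h := sum_odd_prod_sgnVec_eq_zero (T := {a, b, c, d}) (x := a) (y := y) (by simp) (by simp [hya, hyb, hyc, hyd])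
  have hprod : ∀ U : Finset (Fin n), ∏ z ∈ ({a, b, c, d} : Finset (Fin n)), sgnVec U z =
      sgnVec U a * sgnVec U b * (sgnVec U c * sgnVec U d) := by
    intro U
    rw [Finset.prod_insert (by simp [hab, hac, had]), Finset.prod_insert (by simp [hbc, hbd]),
      Finset.prod_pair hcd]
    ring
  simpa [hprod] using h

/-! ## §2 Averages of quadratic forms over the odd half-cube -/

/-- The odd vertex sets. [folklore] -/
def oddSets (n : ℕ) : Finset (Finset (Fin n)) := (univ : Finset (Finset (Fin n))).filter fun U => Odd U.card

/-- There is an odd set (`1 ≤ n`). [folklore] -/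
theorem oddSets_card_pos (hn : 1 ≤ n) : 0 < (oddSets n).card := by
  exact Finset.card_pos.2 ⟨{⟨0, by omega⟩}, by simp [oddSets]⟩

/-- A point outside two given points (`3 ≤ n`). [folklore] -/
theorem exists_ne_two (hn : 3 ≤ n) (a b : Fin n) : ∃ y : Fin n, y ≠ a ∧ y ≠ b := by
  by_contra h
  push Not at h
  have hsub : (univ : Finset (Fin n)) ⊆ {a, b} := fun y _ => by
    simp only [Finset.mem_insert, Finset.mem_singleton]
    by_cases hya : y = a; · exact Or.inl hya
    exact Or.inr (h y hya)
  have h1 := (Finset.card_le_card hsub).trans Finset.card_le_two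
  simp only [Finset.card_univ, Fintype.card_fin] at h1
  omega

/-- A point outside four given points (`5 ≤ n`). [folklore] -/
theorem exists_ne_four (hn : 5 ≤ n) (a b c d : Fin n) : ∃ y : Fin n, y ≠ a ∧ y ≠ b ∧ y ≠ c ∧ y ≠ d := by
  by_contra h
  push Not at h
  have hsub : (univ : Finset (Fin n)) ⊆ {a, b, c, d} := fun y _ => by
    simp only [Finset.mem_insert, Finset.mem_singleton]
    by_cases hya : y = a; · exact Or.inl hya
    by_cases hyb : y = b; · exact Or.inr (Or.inl hyb)
    by_cases hyc : y = c; · exact Or.inr (Or.inr (Or.inl hyc))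
    exact Or.inr (Or.inr (Or.inr (h y hya hyb hyc)))
  have h1 := Finset.card_le_card hsub
  have h2 := (Finset.card_insert_le b ({c, d} : Finset (Fin n))).trans (Nat.succ_le_succ Finset.card_le_two)
  have h3 := Finset.card_insert_le a ({b, c, d} : Finset (Fin n))
  simp only [Finset.card_univ, Fintype.card_fin] at h1
  omega

/-- Expansion of a quadratic form. [folklore] -/
theorem dotProduct_mulVec_expand (Y : Matrix (Fin n) (Fin n) ℝ) (s : Fin n → ℝ) :
    s ⬝ᵥ (Y *ᵥ s) = ∑ i, ∑ j, Y i j * (s i * s j) := by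
  simp only [dotProduct, Matrix.mulVec, Finset.mul_sum]
  refine Finset.sum_congr rfl fun i _ => Finset.sum_congr rfl fun j _ => ?_
  ring

/-- The pair moments of the odd half-cube: `Σ_{U odd} s_U(i) s_U(j) = |O|·[i = j]` (`3 ≤ n`). [folklore] -/
theorem sum_odd_two (hn : 3 ≤ n) (i j : Fin n) :
    ∑ U ∈ oddSets n, sgnVec U i * sgnVec U j = (oddSets n).card * (if i = j then (1 : ℝ) else 0) := by
  by_cases hij : i = j
  · subst hij
    simp [sgnVec_mul_self]
  · obtain ⟨y, hyi, hyj⟩ := exists_ne_two hn i j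
    rw [if_neg hij, mul_zero]
    exact sum_odd_sgnVec_pair_eq_zero hij hyi hyj

/-- The relevant fourth moments of the odd half-cube: for `u ≠ w` (`5 ≤ n`),
`Σ_{U odd} s_U(i) s_U(j) s_U(u) s_U(w) = |O|·([i = u][j = w] + [i = w][j = u])`. [folklore] -/
theorem sum_odd_four (hn : 5 ≤ n) {u w : Fin n} (huw : u ≠ w) (i j : Fin n) :
    ∑ U ∈ oddSets n, sgnVec U i * sgnVec U j * (sgnVec U u * sgnVec U w) =
      (oddSets n).card * ((if i = u then (1 : ℝ) else 0) * (if j = w then 1 else 0) +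
        (if i = w then (1 : ℝ) else 0) * (if j = u then 1 else 0)) := by
  have hO : ∀ U : Finset (Fin n), ∀ v : Fin n, sgnVec U v * sgnVec U v = 1 := sgnVec_mul_self
  have hpair : ∀ a b : Fin n, a ≠ b → ∑ U ∈ oddSets n, sgnVec U a * sgnVec U b = 0 := by
    intro a b hab
    have := sum_odd_two (by omega) a b
    rwa [if_neg hab, mul_zero] at this
  by_cases hij : i = j
  · -- `s_i² s_u s_w = s_u s_w`
    subst hij
    have h1 : ¬ (i = u ∧ i = w) := fun h => huw (h.1.symm.trans h.2)
    have hR : (if i = u then (1 : ℝ) else 0) * (if i = w then 1 else 0) +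
        (if i = w then (1 : ℝ) else 0) * (if i = u then 1 else 0) = 0 := by
      by_cases hiu : i = u
      · have hiw : i ≠ w := fun h => huw (hiu.symm.trans h)
        simp [hiu, huw]
      · simp [hiu]
    rw [hR, mul_zero]
    calc ∑ U ∈ oddSets n, sgnVec U i * sgnVec U i * (sgnVec U u * sgnVec U w)
        = ∑ U ∈ oddSets n, sgnVec U u * sgnVec U w :=
          Finset.sum_congr rfl fun U _ => by rw [hO, one_mul]
      _ = 0 := hpair u w huw
  by_cases hiu : i = u
  · subst hiu
    by_cases hjw : j = w
    · subst hjw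
      simp only [if_true, mul_one, huw, if_false]
      have : ∀ U : Finset (Fin n), sgnVec U i * sgnVec U j * (sgnVec U i * sgnVec U j) = 1 := fun U => by
        rw [show sgnVec U i * sgnVec U j * (sgnVec U i * sgnVec U j) =
          (sgnVec U i * sgnVec U i) * (sgnVec U j * sgnVec U j) by ring, hO, hO, one_mul]
      simp [this]
    · have hjw' : j ≠ w := hjw
      simp only [if_true, if_neg hjw', mul_zero, zero_add, huw, if_false, zero_mul, mul_zero]
      calc ∑ U ∈ oddSets n, sgnVec U i * sgnVec U j * (sgnVec U i * sgnVec U w)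
          = ∑ U ∈ oddSets n, sgnVec U j * sgnVec U w :=
            Finset.sum_congr rfl fun U _ => by
              rw [show sgnVec U i * sgnVec U j * (sgnVec U i * sgnVec U w) =
                (sgnVec U i * sgnVec U i) * (sgnVec U j * sgnVec U w) by ring, hO, one_mul]
        _ = 0 := hpair j w hjw'
  by_cases hiw : i = w
  · subst hiw
    by_cases hju : j = u
    · subst hju
      simp only [if_true, mul_one, if_neg hiu, zero_mul, zero_add]
      have : ∀ U : Finset (Fin n), sgnVec U i * sgnVec U j * (sgnVec U j * sgnVec U i) = 1 := fun U => by
        rw [show sgnVec U i * sgnVec U j * (sgnVec U j * sgnVec U i) =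
          (sgnVec U i * sgnVec U i) * (sgnVec U j * sgnVec U j) by ring, hO, hO, one_mul]
      simp [this]
    · simp only [if_neg hiu, zero_mul, zero_add, if_true, if_neg hju, mul_zero]
      calc ∑ U ∈ oddSets n, sgnVec U i * sgnVec U j * (sgnVec U u * sgnVec U i)
          = ∑ U ∈ oddSets n, sgnVec U j * sgnVec U u :=
            Finset.sum_congr rfl fun U _ => by
              rw [show sgnVec U i * sgnVec U j * (sgnVec U u * sgnVec U i) =
                (sgnVec U i * sgnVec U i) * (sgnVec U j * sgnVec U u) by ring, hO, one_mul]
        _ = 0 := hpair j u hju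
  simp only [if_neg hiu, if_neg hiw, zero_mul, zero_add, mul_zero]
  by_cases hju : j = u
  · subst hju
    calc ∑ U ∈ oddSets n, sgnVec U i * sgnVec U j * (sgnVec U j * sgnVec U w)
        = ∑ U ∈ oddSets n, sgnVec U i * sgnVec U w :=
          Finset.sum_congr rfl fun U _ => by
            rw [show sgnVec U i * sgnVec U j * (sgnVec U j * sgnVec U w) =
              (sgnVec U j * sgnVec U j) * (sgnVec U i * sgnVec U w) by ring, hO, one_mul]
      _ = 0 := hpair i w hiw
  by_cases hjw : j = w
  · subst hjw
    calc ∑ U ∈ oddSets n, sgnVec U i * sgnVec U j * (sgnVec U u * sgnVec U j)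
        = ∑ U ∈ oddSets n, sgnVec U i * sgnVec U u :=
          Finset.sum_congr rfl fun U _ => by
            rw [show sgnVec U i * sgnVec U j * (sgnVec U u * sgnVec U j) =
              (sgnVec U j * sgnVec U j) * (sgnVec U i * sgnVec U u) by ring, hO, one_mul]
      _ = 0 := hpair i u hiu
  obtain ⟨y, hyi, hyj, hyu, hyw⟩ := exists_ne_four hn i j u w
  exact sum_odd_sgnVec_quad_eq_zero hij hiu hiw hju hjw huw hyi hyj hyu hyw

/-- **First moment of a quadratic form:** `Σ_{U odd} s_Uᵀ Y s_U = |O| · tr Y` (`3 ≤ n`). [folklore] -/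
theorem sum_odd_quadForm (hn : 3 ≤ n) (Y : Matrix (Fin n) (Fin n) ℝ) :
    ∑ U ∈ oddSets n, sgnVec U ⬝ᵥ (Y *ᵥ sgnVec U) = (oddSets n).card * ∑ i, Y i i := by
  calc ∑ U ∈ oddSets n, sgnVec U ⬝ᵥ (Y *ᵥ sgnVec U)
      = ∑ U ∈ oddSets n, ∑ i, ∑ j, Y i j * (sgnVec U i * sgnVec U j) :=
        Finset.sum_congr rfl fun U _ => dotProduct_mulVec_expand Y _
    _ = ∑ i, ∑ j, Y i j * ∑ U ∈ oddSets n, sgnVec U i * sgnVec U j := by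
        rw [Finset.sum_comm]
        refine Finset.sum_congr rfl fun i _ => ?_
        rw [Finset.sum_comm]
        refine Finset.sum_congr rfl fun j _ => ?_
        rw [Finset.mul_sum]
    _ = ∑ i, ∑ j, Y i j * ((oddSets n).card * (if i = j then (1 : ℝ) else 0)) := by
        simp_rw [sum_odd_two hn]
    _ = (oddSets n).card * ∑ i, Y i i := by
        rw [Finset.mul_sum]
        refine Finset.sum_congr rfl fun i _ => ?_
        rw [Finset.sum_eq_single i (fun j _ hji => by simp [Ne.symm hji]) (by simp)]
        simp [mul_comm]

/-- **Pair moment of a quadratic form:** for `u ≠ w` (`5 ≤ n`),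
`Σ_{U odd} (s_Uᵀ Y s_U) s_U(u) s_U(w) = |O| · (Y u w + Y w u)`. [folklore] -/
theorem sum_odd_quadForm_pair (hn : 5 ≤ n) (Y : Matrix (Fin n) (Fin n) ℝ) {u w : Fin n} (huw : u ≠ w) :
    ∑ U ∈ oddSets n, (sgnVec U ⬝ᵥ (Y *ᵥ sgnVec U)) * (sgnVec U u * sgnVec U w) =
      (oddSets n).card * (Y u w + Y w u) := by
  have hwu : w ≠ u := Ne.symm huw
  have hA : ∑ i, ∑ j, Y i j * (((oddSets n).card : ℝ) * ((if i = u then (1 : ℝ) else 0) * (if j = w then 1 else 0)))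
      = (oddSets n).card * Y u w := by
    rw [Finset.sum_eq_single u (fun i _ hiu => by simp [hiu]) (by simp),
      Finset.sum_eq_single w (fun j _ hjw => by simp [hjw]) (by simp)]
    simp [mul_comm]
  have hB : ∑ i, ∑ j, Y i j * (((oddSets n).card : ℝ) * ((if i = w then (1 : ℝ) else 0) * (if j = u then 1 else 0)))
      = (oddSets n).card * Y w u := by
    rw [Finset.sum_eq_single w (fun i _ hiw => by simp [hiw]) (by simp),
      Finset.sum_eq_single u (fun j _ hju => by simp [hju]) (by simp)]
    simp [mul_comm]
  calc ∑ U ∈ oddSets n, (sgnVec U ⬝ᵥ (Y *ᵥ sgnVec U)) * (sgnVec U u * sgnVec U w)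
      = ∑ U ∈ oddSets n, ∑ i, ∑ j, Y i j * (sgnVec U i * sgnVec U j * (sgnVec U u * sgnVec U w)) := by
        refine Finset.sum_congr rfl fun U _ => ?_
        rw [dotProduct_mulVec_expand, Finset.sum_mul]
        refine Finset.sum_congr rfl fun i _ => ?_
        rw [Finset.sum_mul]
        refine Finset.sum_congr rfl fun j _ => ?_
        ring
    _ = ∑ i, ∑ j, Y i j * ∑ U ∈ oddSets n, sgnVec U i * sgnVec U j * (sgnVec U u * sgnVec U w) := by
        rw [Finset.sum_comm]
        refine Finset.sum_congr rfl fun i _ => ?_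
        rw [Finset.sum_comm]
        refine Finset.sum_congr rfl fun j _ => ?_
        rw [Finset.mul_sum]
    _ = ∑ i, ∑ j, Y i j * (((oddSets n).card : ℝ) * ((if i = u then (1 : ℝ) else 0) * (if j = w then 1 else 0) +
          (if i = w then (1 : ℝ) else 0) * (if j = u then 1 else 0))) := by
        simp_rw [sum_odd_four hn huw]
    _ = (oddSets n).card * (Y u w + Y w u) := by
        simp_rw [mul_add (((oddSets n).card : ℝ)), mul_add, Finset.sum_add_distrib]
        rw [hA, hB]

/-! ## §3 Degree-2 PSD objects are blind at the matching core, every shift -/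

/-- **Degree-2 PSD blindness at the matching core (ε-uniform).** Let `σ` be a fixed-point-free involution of
`Fin n` (`5 ≤ n`; the perfect matching `M = {{v, σ v}}`), `ε > 0`, and `Y` positive semidefinite. Then the identities
`s_Uᵀ Y s_U = ¼ Σ_v (1 − s_U(v) s_U(σ v)) − ε` (`= |M ∩ δ(U)| − ε`) cannot hold for all ODD `U`: averaging against
`1` and `s_u s_{σu}` forces `tr Y = n/4 − ε` and `Y_{u,σu} = −1/4`, while PSD gives `Y_{uu} + Y_{σu,σu} ≥ 1/2`
and so `tr Y ≥ n/4`. At `ε = 0` the identities DO hold with `Y = (I − A_M)/4 ⪰ 0`. [folklore] -/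
theorem pm_degreeTwo_psd_blind : ∀ {n : ℕ}, 5 ≤ n → ∀ σ : Equiv.Perm (Fin n), (∀ v, σ v ≠ v) →
    (∀ v, σ (σ v) = v) → ∀ {ε : ℝ}, 0 < ε → ∀ Y : Matrix (Fin n) (Fin n) ℝ, Y.PosSemidef →
      ¬ ∀ U : Finset (Fin n), Odd U.card →
        sgnVec U ⬝ᵥ (Y *ᵥ sgnVec U) = (∑ v, (1 - sgnVec U v * sgnVec U (σ v))) / 4 - ε := by
  intro n hn σ hσ hσσ ε hε Y hY h
  have hOpos : (0 : ℝ) < (oddSets n).card := by exact_mod_cast oddSets_card_pos (by omega)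
  have hmem : ∀ U ∈ oddSets n, Odd U.card := fun U hU => (Finset.mem_filter.1 hU).2
  have hsymm : ∀ i j, Y j i = Y i j := fun i j => by simpa using hY.1.apply i j
  -- the crossing term: `Σ_{U odd} Σ_v s_v s_{σv} = 0` and `Σ_{U odd} (Σ_v s_v s_{σv}) s_u s_w = 2|O|`
  have hcross1 : ∑ U ∈ oddSets n, ∑ v, sgnVec U v * sgnVec U (σ v) = 0 := by
    rw [Finset.sum_comm]
    refine Finset.sum_eq_zero fun v _ => ?_
    have := sum_odd_two (by omega) v (σ v)
    rwa [if_neg (Ne.symm (hσ v)), mul_zero] at this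
  -- Step 1: `tr Y = n/4 − ε`
  have htr : ∑ i, Y i i = n / 4 - ε := by
    have hsum : ∑ U ∈ oddSets n, sgnVec U ⬝ᵥ (Y *ᵥ sgnVec U) =
        ∑ U ∈ oddSets n, ((∑ v, (1 - sgnVec U v * sgnVec U (σ v))) / 4 - ε) :=
      Finset.sum_congr rfl fun U hU => h U (hmem U hU)
    rw [sum_odd_quadForm (by omega)] at hsum
    have hrhs : ∑ U ∈ oddSets n, ((∑ v, (1 - sgnVec U v * sgnVec U (σ v))) / 4 - ε) =
        (oddSets n).card * (n / 4 - ε) := by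
      have : ∀ U : Finset (Fin n), (∑ v, (1 - sgnVec U v * sgnVec U (σ v))) / 4 - ε =
          (n / 4 - ε) - (∑ v, sgnVec U v * sgnVec U (σ v)) / 4 := fun U => by
        rw [Finset.sum_sub_distrib]; simp; ring
      simp_rw [this, Finset.sum_sub_distrib, Finset.sum_const, nsmul_eq_mul, ← Finset.sum_div, hcross1]
      ring
    rw [hrhs] at hsum
    exact mul_left_cancel₀ hOpos.ne' hsum
  -- Step 2: `Y u (σ u) = -1/4`
  have hoff : ∀ u, Y u (σ u) = -1 / 4 := by
    intro u
    set w := σ u with hw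
    have huw : u ≠ w := Ne.symm (hσ u)
    have hsum : ∑ U ∈ oddSets n, (sgnVec U ⬝ᵥ (Y *ᵥ sgnVec U)) * (sgnVec U u * sgnVec U w) =
        ∑ U ∈ oddSets n, ((∑ v, (1 - sgnVec U v * sgnVec U (σ v))) / 4 - ε) * (sgnVec U u * sgnVec U w) :=
      Finset.sum_congr rfl fun U hU => by rw [h U (hmem U hU)]
    rw [sum_odd_quadForm_pair hn Y huw] at hsum
    -- the right side equals `-|O|/2`
    have hcross2 : ∑ U ∈ oddSets n, (∑ v, sgnVec U v * sgnVec U (σ v)) * (sgnVec U u * sgnVec U w) =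
        2 * (oddSets n).card := by
      simp_rw [Finset.sum_mul]
      rw [Finset.sum_comm]
      have hterm : ∀ v, ∑ U ∈ oddSets n, sgnVec U v * sgnVec U (σ v) * (sgnVec U u * sgnVec U w) =
          (oddSets n).card * ((if v = u then (1 : ℝ) else 0) * (if σ v = w then 1 else 0) +
            (if v = w then (1 : ℝ) else 0) * (if σ v = u then 1 else 0)) := fun v => sum_odd_four hn huw v (σ v)
      simp_rw [hterm, ← Finset.mul_sum]
      have hin : ∑ v, ((if v = u then (1 : ℝ) else 0) * (if σ v = w then 1 else 0) +
          (if v = w then (1 : ℝ) else 0) * (if σ v = u then 1 else 0)) = 2 := by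
        rw [Finset.sum_add_distrib]
        rw [Finset.sum_eq_single u (fun v _ hvu => by simp [hvu]) (by simp)]
        rw [Finset.sum_eq_single w (fun v _ hvw => by simp [hvw]) (by simp)]
        have hσw : σ w = u := by rw [hw, hσσ]
        simp [← hw, hσw]
        norm_num
      rw [hin]; ring
    have hzero : ∑ U ∈ oddSets n, sgnVec U u * sgnVec U w = 0 := by
      have := sum_odd_two (by omega : 3 ≤ n) u w
      rwa [if_neg huw, mul_zero] at this
    have hrhs : ∑ U ∈ oddSets n, ((∑ v, (1 - sgnVec U v * sgnVec U (σ v))) / 4 - ε) * (sgnVec U u * sgnVec U w) =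
        - ((oddSets n).card : ℝ) / 2 := by
      have : ∀ U : Finset (Fin n), ((∑ v, (1 - sgnVec U v * sgnVec U (σ v))) / 4 - ε) * (sgnVec U u * sgnVec U w)
          = (n / 4 - ε) * (sgnVec U u * sgnVec U w) -
            (∑ v, sgnVec U v * sgnVec U (σ v)) * (sgnVec U u * sgnVec U w) / 4 := fun U => by
        rw [Finset.sum_sub_distrib]; simp; ring
      simp_rw [this, Finset.sum_sub_distrib, ← Finset.mul_sum, hzero, ← Finset.sum_div, hcross2]
      ring
    rw [hrhs, hsymm u w] at hsum
    have : ((oddSets n).card : ℝ) * (2 * Y u w) = ((oddSets n).card : ℝ) * (-1 / 2) := by linarith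
    have := mul_left_cancel₀ hOpos.ne' this
    linarith
  -- Step 3: PSD on `e_u + e_{σu}` gives `Y u u + Y (σu) (σu) ≥ 1/2`
  have hdiag : ∀ u, 1 / 2 ≤ Y u u + Y (σ u) (σ u) := by
    intro u
    set w := σ u with hw
    have huw : u ≠ w := Ne.symm (hσ u)
    set x : Fin n → ℝ := Pi.single u 1 + Pi.single w 1 with hx
    have hpsd := hY.dotProduct_mulVec_nonneg x
    rw [star_trivial] at hpsd
    have hq : x ⬝ᵥ (Y *ᵥ x) = Y u u + Y u w + (Y w u + Y w w) := by
      simp only [hx, Matrix.mulVec_add, Matrix.mulVec_single, add_dotProduct, dotProduct_add,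
        single_dotProduct, MulOpposite.op_one, one_mul, one_smul]
      simp only [Matrix.col_apply]
      ring
    rw [hq, hsymm u w, hoff u] at hpsd
    linarith
  -- Step 4: sum over `u`: `2 tr Y ≥ n/2`, contradiction with Step 1
  have hsum : ∑ u, (Y u u + Y (σ u) (σ u)) = 2 * ∑ i, Y i i := by
    rw [Finset.sum_add_distrib, two_mul, Equiv.sum_comp σ (fun i => Y i i)]
  have hge : (n : ℝ) * (1 / 2) ≤ ∑ u, (Y u u + Y (σ u) (σ u)) := by
    simpa using Finset.sum_le_sum (s := (univ : Finset (Fin n))) fun u _ => hdiag u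
  rw [hsum, htr] at hge
  linarith

end

end Summit.PneNP.PneNP.Cruxes.ConvexGateBlind.StrictRankConicCover
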